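import Mathlib.Analysis.SpecialFunctions.Exponential
import Mathlib.Analysis.Calculus.Deriv.Star
import Mathlib.Analysis.Calculus.Deriv.MeanValue
import Mathlib.Analysis.Calculus.Deriv.Prod
import Mathlib.Analysis.Matrix.Normed
import Literature.Barriers.AtomisticToContinuum.NoBVEstimatesMultiDLinearStepSymmetric
import Literature.Barriers.AtomisticToContinuum.NoBVEstimatesMultiDFinitePropagationOneD
import HarnessLib

/-!
# Rauch's multiplier is bounded: `sup_ξ ‖exp(-T A₀⁻¹(2πi Σ ξⱼAⱼ + B₁))‖ < ∞` for systems in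
Rauch's class (the `L²` well-posedness input of the linear step)

For a constant-coefficient system `A₀∂ₜv + Σ Aⱼ∂ⱼv + B₁v = 0` in Rauch's class at `0`
(symmetrizable, or `A₀` invertible and `A₀⁻¹Σξⱼ Aⱼ` with `k` distinct real eigenvalues for
`ξ ≠ 0`), Rauch's multiplier `M_T(ξ) = rauchSymbol A₀ A B₁ T ξ` (`NoBVEstimatesMultiDLinearStep`)
is bounded uniformly in `ξ ∈ ℝᵈ` (and in `|t| ≤ T`): `exists_norm_rauchSymbol_apply_le`. This is
"the hyperbolicity of (1) shows that (5) is valid with `L¹` replaced by `L²`"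
[Rauch1986, Proof of Theorem p. 483] at the level of symbols — Brenner's standing hypothesis
(0.3) "`sup {|exp(tP(y))| ; y ∈ ℝⁿ, 0 ≤ t ≤ T} < ∞`" for the Cauchy problem to be well posed in
`L₂` [Brenner1973, (0.3) p. 75] — and, with `hasGradientLpBoundWith_two_of_bounded`
(`Literature/Analysis/Fourier/MultiplierOpL2.lean`), the `L²` input of the named fact
`Rauch1986_L1GradientEstimate_imp_LpMultiplier`.

Proof: the energy method in Fourier variables. In both branches of Rauch's class there is a
family of real matrices `R(ω)`, continuous on the unit sphere, with `R(ω)A₀` symmetric positive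
definite and `R(ω)·Σ ωⱼAⱼ` symmetric — the constant symmetrizer `Sym(0)` in the symmetrizable
branch, the symbolic symmetrizer `r(0, ω)` of
`NoBVEstimatesMultiDFinitePropagationOneD.lean` (`IsStrictlyHyperbolicNear.exists_symbolicSymmetrizer`,
built on the polynomial symmetrizer `Literature.LinearAlgebra.Matrix.hornerSymmetrizer`) in the
strictly hyperbolic branch (`exists_continuous_symmetrizer_family`). For
`w(s) = exp(sG')x`, `G' = -T A₀⁻¹(2πiA(ξ) + B₁)`, the energy `E = Re w*(R(ω)A₀)w` (`ω = ξ/|ξ|`)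
satisfies `E' = -2T Re w*(R(ω)B₁)w ≤ 2βE` because `w*(R(ω)A(ξ))w` is real
(`im_star_dotProduct_map_mulVec_of_isSymm`), so `E(1) ≤ e^{2β}E(0)` (`re_quadForm_exp_mulVec_le`,
Gronwall by monotonicity of `e^{-2βs}E(s)`); the constants `m‖x‖² ≤ E ≤ N‖x‖²`, `β` are uniform
on the sphere by compactness (`exists_uniform_quadForm_bounds`). At `ξ = 0` the same argument
runs with `R = A₀ᵀ`.

## References

* [Rauch1986] J. Rauch, Comm. Math. Phys. 106 (1986) 481–484, Proof of Theorem p. 483.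
* [Brenner1973] P. Brenner, Ark. Mat. 11 (1973) 75–101, (0.3) p. 75 and Lemma 5.1 p. 96.
* [Taylor1981] M. E. Taylor, *Pseudodifferential Operators* (1981), Ch. IV §3 (symmetrizers and
  energy estimates for strictly hyperbolic systems).
-/

noncomputable section

open Set Filter Matrix Metric
open scoped Topology ComplexConjugate

namespace Literature.Barriers.AtomisticToContinuum

open Literature.Analysis.FluidPDE Literature.LinearAlgebra.Matrix QuasilinearSystem

variable {d k : ℕ}

/-! ### Quadratic forms of complexified real matrices -/

section QuadForm

/-- Real part of `y*Q_ℂy` for a real matrix `Q`: `aᵀQa + bᵀQb`, `y = a + ib`. [folklore] -/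
theorem re_star_dotProduct_map_mulVec (Q : Matrix (Fin k) (Fin k) ℝ) (y : Fin k → ℂ) :
    (star y ⬝ᵥ (Q.map (algebraMap ℝ ℂ) *ᵥ y)).re =
      (fun i => (y i).re) ⬝ᵥ (Q *ᵥ fun i => (y i).re) +
        (fun i => (y i).im) ⬝ᵥ (Q *ᵥ fun i => (y i).im) := by
  simp only [dotProduct, mulVec, Matrix.map_apply, Complex.coe_algebraMap, Pi.star_apply,
    Finset.mul_sum, Complex.re_sum, ← Finset.sum_add_distrib]
  refine Finset.sum_congr rfl fun i _ => Finset.sum_congr rfl fun j _ => ?_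
  simp only [Complex.mul_re, Complex.mul_im, Complex.star_def, Complex.conj_re, Complex.conj_im,
    Complex.ofReal_re, Complex.ofReal_im]
  ring

/-- Imaginary part of `y*Q_ℂy` for a real matrix `Q`: `aᵀQb - bᵀQa`, `y = a + ib`. [folklore] -/
theorem im_star_dotProduct_map_mulVec (Q : Matrix (Fin k) (Fin k) ℝ) (y : Fin k → ℂ) :
    (star y ⬝ᵥ (Q.map (algebraMap ℝ ℂ) *ᵥ y)).im =
      (fun i => (y i).re) ⬝ᵥ (Q *ᵥ fun i => (y i).im) -
        (fun i => (y i).im) ⬝ᵥ (Q *ᵥ fun i => (y i).re) := by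
  simp only [dotProduct, mulVec, Matrix.map_apply, Complex.coe_algebraMap, Pi.star_apply,
    Finset.mul_sum, Complex.im_sum, ← Finset.sum_sub_distrib]
  refine Finset.sum_congr rfl fun i _ => Finset.sum_congr rfl fun j _ => ?_
  simp only [Complex.mul_re, Complex.mul_im, Complex.star_def, Complex.conj_re, Complex.conj_im,
    Complex.ofReal_re, Complex.ofReal_im]
  ring

/-- For a SYMMETRIC real matrix `Q`, `y*Q_ℂy` is real. [folklore] -/
theorem im_star_dotProduct_map_mulVec_of_isSymm {Q : Matrix (Fin k) (Fin k) ℝ} (hQ : Q.IsSymm)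
    (y : Fin k → ℂ) : (star y ⬝ᵥ (Q.map (algebraMap ℝ ℂ) *ᵥ y)).im = 0 := by
  rw [im_star_dotProduct_map_mulVec, sub_eq_zero, dotProduct_mulVec, ← mulVec_transpose, hQ.eq,
    dotProduct_comm]

/-- For a POSITIVE DEFINITE real matrix `Q` and `y ≠ 0`, `Re y*Q_ℂy > 0`. [folklore] -/
theorem re_star_dotProduct_map_mulVec_pos {Q : Matrix (Fin k) (Fin k) ℝ} (hQ : Q.PosDef)
    {y : Fin k → ℂ} (hy : y ≠ 0) : 0 < (star y ⬝ᵥ (Q.map (algebraMap ℝ ℂ) *ᵥ y)).re := by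
  rw [re_star_dotProduct_map_mulVec]
  have hnn : ∀ v : Fin k → ℝ, 0 ≤ v ⬝ᵥ (Q *ᵥ v) := fun v => by
    rcases eq_or_ne v 0 with rfl | hv
    · simp
    · simpa using (hQ.dotProduct_mulVec_pos hv).le
  by_cases hre : (fun i => (y i).re) = 0
  · have him : (fun i => (y i).im) ≠ 0 := by
      intro him
      apply hy
      funext i
      exact Complex.ext (congr_fun hre i) (congr_fun him i)
    have := hQ.dotProduct_mulVec_pos him
    rw [star_trivial] at this
    exact add_pos_of_nonneg_of_pos (hnn _) this
  · have := hQ.dotProduct_mulVec_pos hre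
    rw [star_trivial] at this
    exact add_pos_of_pos_of_nonneg this (hnn _)

/-- `|y*Q_ℂz| ≤ (Σᵢⱼ |Qᵢⱼ|) ‖y‖ ‖z‖` (sup norms). [folklore] -/
theorem norm_star_dotProduct_map_mulVec_le (Q : Matrix (Fin k) (Fin k) ℝ) (y z : Fin k → ℂ) :
    ‖star y ⬝ᵥ (Q.map (algebraMap ℝ ℂ) *ᵥ z)‖ ≤ (∑ i, ∑ j, |Q i j|) * ‖y‖ * ‖z‖ := by
  simp only [dotProduct, mulVec, Matrix.map_apply, Complex.coe_algebraMap, Pi.star_apply,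
    Finset.mul_sum]
  rw [Finset.sum_mul, Finset.sum_mul]
  refine (norm_sum_le _ _).trans (Finset.sum_le_sum fun i _ => ?_)
  rw [Finset.sum_mul, Finset.sum_mul]
  refine (norm_sum_le _ _).trans (Finset.sum_le_sum fun j _ => ?_)
  rw [norm_mul, norm_mul, norm_star]
  have h1 : ‖y i‖ ≤ ‖y‖ := norm_le_pi_norm y i
  have h2 : ‖z j‖ ≤ ‖z‖ := norm_le_pi_norm z j
  have h3 : ‖(Q i j : ℂ)‖ = |Q i j| := by
    rw [Complex.norm_real, Real.norm_eq_abs]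
  rw [h3]
  calc ‖y i‖ * (|Q i j| * ‖z j‖) = |Q i j| * ‖y i‖ * ‖z j‖ := by ring
    _ ≤ |Q i j| * ‖y‖ * ‖z‖ := by gcongr

/-- Homogeneity: `(cy)*Q(cy) = c² · y*Qy` for real `c`. [folklore] -/
theorem star_dotProduct_mulVec_real_smul (P : Matrix (Fin k) (Fin k) ℂ) (c : ℝ) (y : Fin k → ℂ) :
    star ((c : ℂ) • y) ⬝ᵥ (P *ᵥ ((c : ℂ) • y)) = ((c ^ 2 : ℝ) : ℂ) * (star y ⬝ᵥ (P *ᵥ y)) := by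
  rw [star_smul, mulVec_smul, dotProduct_smul, smul_dotProduct, smul_smul, Complex.star_def,
    Complex.conj_ofReal, smul_eq_mul]
  push_cast
  ring

end QuadForm

/-! ### The energy inequality for `w(s) = exp(sG)x` -/

section Energy

open scoped Matrix.Norms.Operator

/-- `M ↦ M x` as a real-linear continuous map on complex matrices. [folklore] -/
def mulVecRightCLM (x : Fin k → ℂ) : Matrix (Fin k) (Fin k) ℂ →L[ℝ] (Fin k → ℂ) :=
  LinearMap.toContinuousLinearMap
    { toFun := fun M => M *ᵥ x
      map_add' := fun _ _ => Matrix.add_mulVec _ _ _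
      map_smul' := fun c M => by rw [Matrix.smul_mulVec, RingHom.id_apply] }

/-- `s ↦ exp(sG)x` has derivative `G exp(sG)x`. [folklore] -/
theorem hasDerivAt_exp_smul_mulVec (G : Matrix (Fin k) (Fin k) ℂ) (x : Fin k → ℂ) (s : ℝ) :
    HasDerivAt (fun s : ℝ => NormedSpace.exp (s • G) *ᵥ x)
      (G *ᵥ (NormedSpace.exp (s • G) *ᵥ x)) s := by
  have h := (mulVecRightCLM x).hasFDerivAt.comp_hasDerivAt s
    (hasDerivAt_exp_smul_const' (𝕂 := ℝ) G s)
  rw [mulVec_mulVec]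
  exact h

/-- The sesquilinear form `y*Pz` as a double sum. [folklore] -/
theorem star_dotProduct_mulVec_eq_sum (P : Matrix (Fin k) (Fin k) ℂ) (y z : Fin k → ℂ) :
    star y ⬝ᵥ (P *ᵥ z) = ∑ i, ∑ j, star (y i) * (P i j * z j) := by
  simp only [dotProduct, mulVec, Pi.star_apply, Finset.mul_sum]

/-- Hermitian symmetry: `z*Py = conj(y*Pz)` for hermitean `P`. [folklore] -/
theorem star_star_dotProduct_mulVec {P : Matrix (Fin k) (Fin k) ℂ} (hP : P.IsHermitian)
    (y z : Fin k → ℂ) : star (star y ⬝ᵥ (P *ᵥ z)) = star z ⬝ᵥ (P *ᵥ y) := by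
  rw [← star_dotProduct_star, star_star, star_mulVec, hP.eq, dotProduct_mulVec]

/-- **Energy inequality.** Let `P` be hermitean and `G` such that
`Re y*(PG)y ≤ β · Re y*Py` for all `y`. Then along `w(s) = exp(sG)x` the energy grows at most
exponentially: `Re w(t)*Pw(t) ≤ e^{2βt} Re x*Px` for `t ≥ 0` (since
`(e^{-2βs} Re w*Pw)' = 2e^{-2βs}(Re w*PGw - β Re w*Pw) ≤ 0`).
[cite: Brenner1973, (0.3) p. 75; Taylor1981, Ch. IV §3] -/
theorem re_quadForm_exp_mulVec_le {P G : Matrix (Fin k) (Fin k) ℂ} (hP : P.IsHermitian) {β : ℝ}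
    (hG : ∀ y, (star y ⬝ᵥ ((P * G) *ᵥ y)).re ≤ β * (star y ⬝ᵥ (P *ᵥ y)).re) (x : Fin k → ℂ)
    {t : ℝ} (ht : 0 ≤ t) :
    (star (NormedSpace.exp (t • G) *ᵥ x) ⬝ᵥ (P *ᵥ (NormedSpace.exp (t • G) *ᵥ x))).re ≤
      Real.exp (2 * β * t) * (star x ⬝ᵥ (P *ᵥ x)).re := by
  set w : ℝ → (Fin k → ℂ) := fun s => NormedSpace.exp (s • G) *ᵥ x with hw
  have hwd : ∀ s, HasDerivAt w (G *ᵥ w s) s := fun s => hasDerivAt_exp_smul_mulVec G x s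
  have hwi : ∀ s i, HasDerivAt (fun s => w s i) ((G *ᵥ w s) i) s :=
    fun s i => (hasDerivAt_pi.1 (hwd s)) i
  -- derivative of the energy `q(s) = w(s)* P w(s)`
  have hqd : ∀ s, HasDerivAt (fun s => star (w s) ⬝ᵥ (P *ᵥ w s))
      (star (G *ᵥ w s) ⬝ᵥ (P *ᵥ w s) + star (w s) ⬝ᵥ (P *ᵥ (G *ᵥ w s))) s := by
    intro s
    have h : HasDerivAt (fun s => ∑ i, ∑ j, star (w s i) * (P i j * w s j))
        (∑ i, ∑ j, (star ((G *ᵥ w s) i) * (P i j * w s j) +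
          star (w s i) * (P i j * (G *ᵥ w s) j))) s := by
      refine HasDerivAt.fun_sum fun i _ => HasDerivAt.fun_sum fun j _ => ?_
      exact ((hwi s i).star).fun_mul ((hwi s j).const_mul (P i j))
    have e1 : (fun s => ∑ i, ∑ j, star (w s i) * (P i j * w s j)) =
        fun s => star (w s) ⬝ᵥ (P *ᵥ w s) :=
      funext fun s => (star_dotProduct_mulVec_eq_sum P (w s) (w s)).symm
    rw [e1] at h
    convert h using 1
    rw [star_dotProduct_mulVec_eq_sum, star_dotProduct_mulVec_eq_sum, ← Finset.sum_add_distrib]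
    refine Finset.sum_congr rfl fun i _ => ?_
    rw [← Finset.sum_add_distrib]
  -- its real part is `2 Re w* P (G w)`
  have hre : ∀ s, HasDerivAt (fun s => (star (w s) ⬝ᵥ (P *ᵥ w s)).re)
      (2 * (star (w s) ⬝ᵥ ((P * G) *ᵥ w s)).re) s := by
    intro s
    have h := (Complex.reCLM.hasFDerivAt.comp_hasDerivAt s (hqd s))
    have hval : Complex.reCLM (star (G *ᵥ w s) ⬝ᵥ (P *ᵥ w s) + star (w s) ⬝ᵥ (P *ᵥ (G *ᵥ w s))) =
        2 * (star (w s) ⬝ᵥ ((P * G) *ᵥ w s)).re := by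
      rw [Complex.reCLM_apply, Complex.add_re, ← star_star_dotProduct_mulVec hP (w s) (G *ᵥ w s),
        Complex.star_def, Complex.conj_re, mulVec_mulVec, two_mul]
    rw [hval] at h
    exact h
  -- `f(s) = e^{-2βs} Re q(s)` is nonincreasing
  set f : ℝ → ℝ := fun s => Real.exp (-(2 * β) * s) * (star (w s) ⬝ᵥ (P *ᵥ w s)).re with hf
  have hfd : ∀ s, HasDerivAt f (Real.exp (-(2 * β) * s) * (-(2 * β)) *
      (star (w s) ⬝ᵥ (P *ᵥ w s)).re +
        Real.exp (-(2 * β) * s) * (2 * (star (w s) ⬝ᵥ ((P * G) *ᵥ w s)).re)) s := by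
    intro s
    have hexp : HasDerivAt (fun s => Real.exp (-(2 * β) * s)) (Real.exp (-(2 * β) * s) * (-(2 * β))) s := by
      have := ((hasDerivAt_id s).const_mul (-(2 * β))).exp
      simpa using this
    exact hexp.mul (hre s)
  have hanti : Antitone f := by
    refine antitone_of_deriv_nonpos (fun s => (hfd s).differentiableAt) fun s => ?_
    rw [(hfd s).deriv]
    have hpos : 0 < Real.exp (-(2 * β) * s) := Real.exp_pos _
    have key := hG (w s)
    nlinarith [key, hpos]
  have h0 : f 0 = (star x ⬝ᵥ (P *ᵥ x)).re := by
    simp [hf, hw, NormedSpace.exp_zero]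
  have hft := hanti ht
  rw [h0] at hft
  -- unfold `f t` and multiply by `e^{2βt}`
  change Real.exp (-(2 * β) * t) * (star (w t) ⬝ᵥ (P *ᵥ w t)).re ≤ _ at hft
  have hpos : 0 < Real.exp (2 * β * t) := Real.exp_pos _
  have hmul := mul_le_mul_of_nonneg_left hft hpos.le
  rw [← mul_assoc, ← Real.exp_add, show 2 * β * t + -(2 * β) * t = 0 by ring, Real.exp_zero,
    one_mul] at hmul
  exact hmul

end Energy

/-! ### Uniform bounds for the quadratic forms of a continuous family on a compact set -/

section Uniform

/-- **Uniform coercivity and boundedness.** Let `Q : X → Matrix` be continuous on a compact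
set `K` with `Q(p)` real symmetric positive definite for `p ∈ K`. Then there are `0 < m` and `N`
with `m‖y‖² ≤ Re y*Q(p)_ℂy` and `Σᵢⱼ|Q(p)ᵢⱼ| ≤ N` for all `p ∈ K` and `y ∈ ℂᵏ` (compactness
of `K × {‖y‖ = 1}` and homogeneity). [folklore] -/
theorem exists_uniform_quadForm_bounds {X : Type*} [TopologicalSpace X] {K : Set X}
    (hK : IsCompact K) {Q : X → Matrix (Fin k) (Fin k) ℝ} (hQ : ContinuousOn Q K)
    (hpd : ∀ p ∈ K, (Q p).PosDef) :
    ∃ m N : ℝ, 0 < m ∧ (∀ p ∈ K, ∀ y : Fin k → ℂ,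
      m * ‖y‖ ^ 2 ≤ (star y ⬝ᵥ ((Q p).map (algebraMap ℝ ℂ) *ᵥ y)).re) ∧
      ∀ p ∈ K, ∑ i, ∑ j, |Q p i j| ≤ N := by
  -- the entry bound `N`
  have hcont_abs : ContinuousOn (fun p => ∑ i, ∑ j, |Q p i j|) K :=
    continuousOn_finsetSum _ fun i _ => continuousOn_finsetSum _ fun j _ =>
      continuous_abs.comp_continuousOn ((continuous_apply j).comp_continuousOn
        ((continuous_apply i).comp_continuousOn hQ))
  obtain ⟨N, hN⟩ := hK.bddAbove_image hcont_abs
  have hN' : ∀ p ∈ K, ∑ i, ∑ j, |Q p i j| ≤ N := fun p hp => hN ⟨p, hp, rfl⟩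
  -- the coercivity constant: minimum of the form on `K × unit sphere` (if nonempty)
  set F : X × (Fin k → ℂ) → ℝ := fun q =>
    (star q.2 ⬝ᵥ ((Q q.1).map (algebraMap ℝ ℂ) *ᵥ q.2)).re with hF
  have hFcont : ContinuousOn F (K ×ˢ sphere (0 : Fin k → ℂ) 1) := by
    have hsum : ∀ q : X × (Fin k → ℂ), F q =
        ∑ i, ∑ j, (star (q.2 i) * ((algebraMap ℝ ℂ) (Q q.1 i j) * q.2 j)).re := by
      intro q
      simp only [hF, star_dotProduct_mulVec_eq_sum, Matrix.map_apply, Complex.re_sum]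
    rw [show F = fun q => ∑ i, ∑ j, (star (q.2 i) * ((algebraMap ℝ ℂ) (Q q.1 i j) * q.2 j)).re
      from funext hsum]
    refine continuousOn_finsetSum _ fun i _ => continuousOn_finsetSum _ fun j _ => ?_
    refine Complex.continuous_re.comp_continuousOn ?_
    refine ContinuousOn.fun_mul ?_ (ContinuousOn.fun_mul ?_ ?_)
    · exact (continuous_star.comp ((continuous_apply i).comp continuous_snd)).continuousOn
    · exact ((continuous_algebraMap ℝ ℂ).comp_continuousOn
        (((continuous_apply j).comp_continuousOn ((continuous_apply i).comp_continuousOn hQ)).comp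
          continuousOn_fst (fun q hq => (mem_prod.1 hq).1)))
    · exact ((continuous_apply j).comp continuous_snd).continuousOn
  have hcpt : IsCompact (K ×ˢ sphere (0 : Fin k → ℂ) 1) := hK.prod (isCompact_sphere _ _)
  rcases (K ×ˢ sphere (0 : Fin k → ℂ) 1).eq_empty_or_nonempty with hempty | hne
  · -- no pair `(p, y)` with `‖y‖ = 1`: the coercivity is vacuous with `m = 1`
    refine ⟨1, N, one_pos, fun p hp y => ?_, hN'⟩
    rcases eq_or_ne y 0 with rfl | hy
    · simp
    · exfalso
      have hmem : (p, (‖y‖⁻¹ : ℂ) • y) ∈ K ×ˢ sphere (0 : Fin k → ℂ) 1 := by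
        refine mem_prod.2 ⟨hp, ?_⟩
        rw [mem_sphere_zero_iff_norm, norm_smul, norm_inv, Complex.norm_real, Real.norm_eq_abs,
          abs_norm, inv_mul_cancel₀ (norm_ne_zero_iff.2 hy)]
      rw [hempty] at hmem
      exact hmem
  obtain ⟨q₀, hq₀, hmin⟩ := hcpt.exists_isMinOn hne hFcont
  have hq₀K : q₀.1 ∈ K := (mem_prod.1 hq₀).1
  have hq₀S : ‖q₀.2‖ = 1 := mem_sphere_zero_iff_norm.1 (mem_prod.1 hq₀).2
  have hm : 0 < F q₀ := by
    have hy0 : q₀.2 ≠ 0 := by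
      intro h0; rw [h0, norm_zero] at hq₀S; exact zero_ne_one hq₀S
    exact re_star_dotProduct_map_mulVec_pos (hpd _ hq₀K) hy0
  refine ⟨F q₀, N, hm, fun p hp y => ?_, hN'⟩
  rcases eq_or_ne y 0 with rfl | hy
  · simp
  · have hny : ‖y‖ ≠ 0 := norm_ne_zero_iff.2 hy
    set u : Fin k → ℂ := (‖y‖⁻¹ : ℂ) • y with hu
    have humem : (p, u) ∈ K ×ˢ sphere (0 : Fin k → ℂ) 1 := by
      refine mem_prod.2 ⟨hp, ?_⟩
      rw [mem_sphere_zero_iff_norm, hu, norm_smul, norm_inv, Complex.norm_real, Real.norm_eq_abs,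
        abs_norm, inv_mul_cancel₀ hny]
    have hle : F q₀ ≤ F (p, u) := (isMinOn_iff.1 hmin) _ humem
    have hyu : y = (‖y‖ : ℂ) • u := by
      rw [hu, smul_smul, ← Complex.ofReal_inv, ← Complex.ofReal_mul, mul_inv_cancel₀ hny,
        Complex.ofReal_one, one_smul]
    have hscale : (star y ⬝ᵥ ((Q p).map (algebraMap ℝ ℂ) *ᵥ y)).re =
        ‖y‖ ^ 2 * (star u ⬝ᵥ ((Q p).map (algebraMap ℝ ℂ) *ᵥ u)).re := by
      conv_lhs => rw [hyu]
      rw [star_dotProduct_mulVec_real_smul, Complex.re_ofReal_mul]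
    rw [hscale, mul_comm]
    exact mul_le_mul_of_nonneg_left hle (sq_nonneg _)

end Uniform

/-! ### Symmetrizer families for the two branches of Rauch's class -/

section Family

/-- **A symmetrizer family for a constant-coefficient system in Rauch's class at `0`**: real
matrices `R(ω)`, continuous in `ω`, with `R(ω)A₀` symmetric positive definite and
`R(ω) Σⱼ ωⱼAⱼ` symmetric for every `ω ≠ 0`; moreover `det A₀ ≠ 0`. In the symmetrizable branch
`R ≡ Sym(0)`; in the strictly hyperbolic branch `R(ω) = r(0, ω)` is the symbolic symmetrizer
(`IsStrictlyHyperbolicNear.exists_symbolicSymmetrizer`). [cite: Rauch1986, p. 482;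
Taylor1981, Ch. IV §3 Prop. 3.1] -/
theorem exists_continuous_symmetrizer_family {A₀ : Matrix (Fin k) (Fin k) ℝ}
    {A : Fin d → Matrix (Fin k) (Fin k) ℝ} {B₁ : (Fin k → ℝ) →L[ℝ] (Fin k → ℝ)}
    (hS : (ofConstant A₀ A B₁).IsRauchClass 0) :
    A₀.det ≠ 0 ∧ ∃ R : (Fin d → ℝ) → Matrix (Fin k) (Fin k) ℝ, Continuous R ∧
      ∀ ω : Fin d → ℝ, ω ≠ 0 →
        (R ω * A₀).PosDef ∧ (R ω * A₀).IsSymm ∧ (R ω * ∑ j, ω j • A j).IsSymm := by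
  obtain ⟨U, hU, hcases⟩ := hS.hyperbolic
  rcases hcases with ⟨Sym, -, hSym⟩ | hsh
  · -- symmetrizable branch: the constant symmetrizer `Sym 0`
    have h0 := hSym 0 (mem_of_mem_nhds hU)
    simp only [ofConstant_A0, ofConstant_A] at h0
    have hdet : A₀.det ≠ 0 := by
      intro hd
      have := h0.1.det_pos
      rw [det_mul, hd, mul_zero] at this
      exact lt_irrefl _ this
    refine ⟨hdet, fun _ => Sym 0, continuous_const, fun ω _ => ⟨h0.1, ?_, ?_⟩⟩
    · have h := h0.1.isHermitian
      rwa [Matrix.IsHermitian, conjTranspose_eq_transpose_of_trivial] at h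
    · unfold Matrix.IsSymm
      rw [Finset.mul_sum, transpose_sum]
      refine Finset.sum_congr rfl fun j _ => ?_
      rw [Matrix.mul_smul, transpose_smul, (h0.2 j).eq]
  · -- strictly hyperbolic branch: the symbolic symmetrizer at the state `0`
    have hnear : (ofConstant A₀ A B₁).IsStrictlyHyperbolicNear 0 := ⟨U, hU, hsh⟩
    have hdet : A₀.det ≠ 0 := by
      have := (hsh 0 (mem_of_mem_nhds hU)).1
      simpa using this
    obtain ⟨U', hU', r, hr, hr'⟩ := hnear.exists_symbolicSymmetrizer
    refine ⟨hdet, fun ω => r 0 ω, ?_, fun ω hω => ?_⟩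
    · refine continuous_pi fun i => continuous_pi fun i' => ?_
      exact ((hr i i').continuous.comp (continuous_const.prodMk continuous_id) :)
    · have h := hr' 0 (mem_of_mem_nhds hU') ω hω
      simp only [ofConstant_A0, ofConstant_A] at h
      exact h

end Family

/-! ### The bound -/

section Bound

open scoped Matrix.Norms.Operator

/-- **The generator through a symmetrizer**: for a real matrix `R`,
`(RA₀)_ℂ · rauchGenerator A₀ A B₁ ξ = 2πi (R Σ ξ_l A_l)_ℂ + (R B₁)_ℂ` when `det A₀ ≠ 0`.
[cite: Rauch1986, Proof of Theorem p. 483] -/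
theorem map_mul_A0_mul_rauchGenerator {A₀ : Matrix (Fin k) (Fin k) ℝ} (hdet : A₀.det ≠ 0)
    (A : Fin d → Matrix (Fin k) (Fin k) ℝ) (B₁ : (Fin k → ℝ) →L[ℝ] (Fin k → ℝ))
    (R : Matrix (Fin k) (Fin k) ℝ) (ξ : Space d) :
    (R * A₀).map (algebraMap ℝ ℂ) * rauchGenerator A₀ A B₁ ξ =
      (2 * Real.pi * Complex.I) • (R * ∑ l, ξ l • A l).map (algebraMap ℝ ℂ) +
        (R * LinearMap.toMatrix' (B₁ : (Fin k → ℝ) →ₗ[ℝ] (Fin k → ℝ))).map (algebraMap ℝ ℂ) := by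
  have hunit : IsUnit A₀.det := isUnit_iff_ne_zero.2 hdet
  have h1 : (R * A₀).map (algebraMap ℝ ℂ) * (A₀⁻¹).map (algebraMap ℝ ℂ) = R.map (algebraMap ℝ ℂ) := by
    rw [← Matrix.map_mul, Matrix.mul_assoc, mul_nonsing_inv _ hunit, Matrix.mul_one]
  unfold rauchGenerator
  rw [← Matrix.mul_assoc, h1, Matrix.mul_add]
  congr 1
  · rw [Matrix.map_mul, ← IsStrictlyHyperbolicPencil.sum_smul_map_eq, Finset.mul_sum, Finset.mul_sum,
      Finset.smul_sum]
    refine Finset.sum_congr rfl fun l _ => ?_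
    rw [Matrix.mul_smul, Matrix.mul_smul, smul_smul]
    congr 1
    ring
  · rw [Matrix.map_mul]

/-- **The energy hypothesis for Rauch's generator.** With `P = (RA₀)_ℂ` and
`G' = -T · rauchGenerator A₀ A B₁ ξ`, if `R Σ ξ_l A_l` is symmetric then
`Re y*(PG')y = -T Re y*(RB₁)_ℂy ≤ |T| (Σ|(RB₁)ᵢⱼ|) ‖y‖²` — the principal part drops out.
[cite: Rauch1986, Proof of Theorem p. 483; Brenner1973, (0.3) p. 75] -/
theorem re_quadForm_generator_le {A₀ : Matrix (Fin k) (Fin k) ℝ} (hdet : A₀.det ≠ 0)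
    (A : Fin d → Matrix (Fin k) (Fin k) ℝ) (B₁ : (Fin k → ℝ) →L[ℝ] (Fin k → ℝ))
    {R : Matrix (Fin k) (Fin k) ℝ} {ξ : Space d} (hsymm : (R * ∑ l, ξ l • A l).IsSymm) (T : ℝ)
    (y : Fin k → ℂ) :
    (star y ⬝ᵥ (((R * A₀).map (algebraMap ℝ ℂ) * (-(T : ℂ) • rauchGenerator A₀ A B₁ ξ)) *ᵥ y)).re ≤
      |T| * (∑ i, ∑ j, |(R * LinearMap.toMatrix' (B₁ : (Fin k → ℝ) →ₗ[ℝ] (Fin k → ℝ))) i j|) *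
        ‖y‖ ^ 2 := by
  set Bm : Matrix (Fin k) (Fin k) ℝ := LinearMap.toMatrix' (B₁ : (Fin k → ℝ) →ₗ[ℝ] (Fin k → ℝ))
    with hBm
  rw [Matrix.mul_smul, map_mul_A0_mul_rauchGenerator hdet, ← hBm, smul_add, Matrix.add_mulVec,
    dotProduct_add, Complex.add_re, smul_mulVec, smul_mulVec, dotProduct_smul, dotProduct_smul,
    smul_mulVec, dotProduct_smul]
  -- the principal term is purely imaginary
  have hprin : ((-(T : ℂ)) • ((2 * Real.pi * Complex.I) •
      (star y ⬝ᵥ ((R * ∑ l, ξ l • A l).map (algebraMap ℝ ℂ) *ᵥ y)))).re = 0 := by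
    have him := im_star_dotProduct_map_mulVec_of_isSymm hsymm y
    set z := star y ⬝ᵥ ((R * ∑ l, ξ l • A l).map (algebraMap ℝ ℂ) *ᵥ y) with hz
    rw [smul_eq_mul, smul_eq_mul]
    have hzre : z = (z.re : ℂ) := by
      rw [Complex.ext_iff]; simp [him]
    rw [hzre]
    simp only [Complex.mul_re, Complex.neg_re, Complex.neg_im, Complex.ofReal_re, Complex.ofReal_im,
      Complex.mul_im, Complex.I_re, Complex.I_im, Complex.re_ofNat, Complex.im_ofNat]
    ring
  rw [hprin, zero_add, smul_eq_mul]
  calc ((-(T : ℂ)) * (star y ⬝ᵥ ((R * Bm).map (algebraMap ℝ ℂ) *ᵥ y))).re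
      ≤ ‖(-(T : ℂ)) * (star y ⬝ᵥ ((R * Bm).map (algebraMap ℝ ℂ) *ᵥ y))‖ := Complex.re_le_norm _
    _ = |T| * ‖star y ⬝ᵥ ((R * Bm).map (algebraMap ℝ ℂ) *ᵥ y)‖ := by
        rw [norm_mul, norm_neg, Complex.norm_real, Real.norm_eq_abs]
    _ ≤ |T| * ((∑ i, ∑ j, |(R * Bm) i j|) * ‖y‖ * ‖y‖) := by
        gcongr
        exact norm_star_dotProduct_map_mulVec_le _ _ _
    _ = |T| * (∑ i, ∑ j, |(R * Bm) i j|) * ‖y‖ ^ 2 := by ring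

/-- **The pointwise bound from a symmetrizer.** If `RA₀` is symmetric with
`m‖y‖² ≤ Re y*(RA₀)_ℂy`, `Σ|(RA₀)ᵢⱼ| ≤ N`, `Σ|(RB₁)ᵢⱼ| ≤ N'`, and `R Σ ξ_lA_l` is symmetric,
then every entry of `rauchSymbol A₀ A B₁ T ξ` is bounded by
`√(e^{2|T|N'/m} N / m)`. [cite: Brenner1973, (0.3) p. 75] -/
theorem norm_rauchSymbol_apply_le_of_symmetrizer {A₀ : Matrix (Fin k) (Fin k) ℝ} (hdet : A₀.det ≠ 0)
    (A : Fin d → Matrix (Fin k) (Fin k) ℝ) (B₁ : (Fin k → ℝ) →L[ℝ] (Fin k → ℝ))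
    {R : Matrix (Fin k) (Fin k) ℝ} {ξ : Space d} (hsymm₀ : (R * A₀).IsSymm)
    (hsymm : (R * ∑ l, ξ l • A l).IsSymm) {m N N' : ℝ} (hm : 0 < m)
    (hcoer : ∀ y : Fin k → ℂ, m * ‖y‖ ^ 2 ≤ (star y ⬝ᵥ ((R * A₀).map (algebraMap ℝ ℂ) *ᵥ y)).re)
    (hN : ∑ i, ∑ j, |(R * A₀) i j| ≤ N)
    (hN' : ∑ i, ∑ j, |(R * LinearMap.toMatrix' (B₁ : (Fin k → ℝ) →ₗ[ℝ] (Fin k → ℝ))) i j| ≤ N')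
    (T : ℝ) (a b : Fin k) :
    ‖rauchSymbol A₀ A B₁ T ξ a b‖ ≤ Real.sqrt (Real.exp (2 * (|T| * N' / m)) * N / m) := by
  set P : Matrix (Fin k) (Fin k) ℂ := (R * A₀).map (algebraMap ℝ ℂ) with hP
  set G' : Matrix (Fin k) (Fin k) ℂ := -(T : ℂ) • rauchGenerator A₀ A B₁ ξ with hG'
  have hPh : P.IsHermitian := isHermitian_map_of_isSymm hsymm₀
  have hN'0 : 0 ≤ N' := le_trans (Finset.sum_nonneg fun i _ => Finset.sum_nonneg fun j _ => abs_nonneg _) hN'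
  have hN0 : 0 ≤ N := le_trans (Finset.sum_nonneg fun i _ => Finset.sum_nonneg fun j _ => abs_nonneg _) hN
  -- the energy hypothesis with `β = |T| N' / m`
  have hG : ∀ y, (star y ⬝ᵥ ((P * G') *ᵥ y)).re ≤ (|T| * N' / m) * (star y ⬝ᵥ (P *ᵥ y)).re := by
    intro y
    refine (re_quadForm_generator_le hdet A B₁ hsymm T y).trans ?_
    calc |T| * (∑ i, ∑ j, |(R * LinearMap.toMatrix' (B₁ : (Fin k → ℝ) →ₗ[ℝ] (Fin k → ℝ))) i j|) *
          ‖y‖ ^ 2 ≤ |T| * N' * ‖y‖ ^ 2 := by gcongr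
      _ = (|T| * N' / m) * (m * ‖y‖ ^ 2) := by field_simp
      _ ≤ (|T| * N' / m) * (star y ⬝ᵥ (P *ᵥ y)).re := by
          refine mul_le_mul_of_nonneg_left (hcoer y) ?_
          positivity
  -- the multiplier is `exp(1 • G')`
  have hexp : NormedSpace.exp ((1 : ℝ) • G') = rauchSymbol A₀ A B₁ T ξ := by
    rw [one_smul]
    rfl
  set x : Fin k → ℂ := Pi.single b 1 with hx
  have hx1 : ‖x‖ = 1 := by
    rw [hx, Pi.norm_single, norm_one]
  have hE := re_quadForm_exp_mulVec_le hPh hG x zero_le_one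
  rw [mul_one, hexp] at hE
  set Mx := rauchSymbol A₀ A B₁ T ξ *ᵥ x with hMx
  -- `m ‖Mx‖² ≤ E(Mx) ≤ e^{2β} E(x) ≤ e^{2β} N`
  have hEx : (star x ⬝ᵥ (P *ᵥ x)).re ≤ N := by
    refine (Complex.re_le_norm _).trans ((norm_star_dotProduct_map_mulVec_le _ _ _).trans ?_)
    rw [hx1, mul_one, mul_one]
    exact hN
  have hMx2 : ‖Mx‖ ^ 2 ≤ Real.exp (2 * (|T| * N' / m)) * N / m := by
    rw [le_div_iff₀ hm, mul_comm]
    refine (hcoer Mx).trans (hE.trans ?_)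
    exact mul_le_mul_of_nonneg_left hEx (Real.exp_pos _).le
  have hentry : ‖rauchSymbol A₀ A B₁ T ξ a b‖ ≤ ‖Mx‖ := by
    have h1 : rauchSymbol A₀ A B₁ T ξ a b = Mx a := by
      rw [hMx, hx, mulVec_single_one, Matrix.col_apply]
    rw [h1]
    exact norm_le_pi_norm Mx a
  refine hentry.trans ?_
  rw [← Real.sqrt_sq (norm_nonneg Mx)]
  exact Real.sqrt_le_sqrt hMx2

/-- **Rauch's multiplier is bounded** (uniformly in `ξ ∈ ℝᵈ` and `|t| ≤ T`): for a
constant-coefficient system in Rauch's class at `0` there is `C₀` with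
`|rauchSymbol A₀ A B₁ t ξ _{ab}| ≤ C₀` for all `ξ`, `|t| ≤ T`, `a, b` — Brenner's hypothesis
(0.3) `sup {|exp(tP(y))| : y ∈ ℝⁿ, 0 ≤ t ≤ T} < ∞` for the linearised problem (4), "the
hyperbolicity of (1) shows that (5) is valid with `L¹` replaced by `L²`".
[cite: Rauch1986, Proof of Theorem p. 483; Brenner1973, (0.3) p. 75] -/
theorem exists_norm_rauchSymbol_apply_le {A₀ : Matrix (Fin k) (Fin k) ℝ}
    {A : Fin d → Matrix (Fin k) (Fin k) ℝ} {B₁ : (Fin k → ℝ) →L[ℝ] (Fin k → ℝ)}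
    (hS : (ofConstant A₀ A B₁).IsRauchClass 0) (T : ℝ) :
    ∃ C₀ : ℝ, ∀ t : ℝ, |t| ≤ T → ∀ (ξ : Space d) (a b : Fin k),
      ‖rauchSymbol A₀ A B₁ t ξ a b‖ ≤ C₀ := by
  obtain ⟨hdet, R, hRc, hR⟩ := exists_continuous_symmetrizer_family hS
  set Bm : Matrix (Fin k) (Fin k) ℝ := LinearMap.toMatrix' (B₁ : (Fin k → ℝ) →ₗ[ℝ] (Fin k → ℝ))
    with hBm
  -- constants on the unit sphere `ω ≠ 0`
  have hKc : IsCompact (sphere (0 : Fin d → ℝ) 1) := isCompact_sphere _ _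
  have hne0 : ∀ ω ∈ sphere (0 : Fin d → ℝ) 1, ω ≠ 0 := fun ω hω h0 => by
    rw [h0, mem_sphere_zero_iff_norm, norm_zero] at hω; exact zero_ne_one hω
  obtain ⟨m, N, hm, hcoer, hN⟩ := exists_uniform_quadForm_bounds (k := k) hKc
    ((hRc.fun_mul continuous_const).continuousOn) (fun ω hω => (hR ω (hne0 ω hω)).1)
  -- entry bound for `R(ω) B₁` on the sphere
  have hcontB : ContinuousOn (fun ω => ∑ i, ∑ j, |(R ω * Bm) i j|) (sphere (0 : Fin d → ℝ) 1) :=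
    (continuous_finsetSum _ fun i _ => continuous_finsetSum _ fun j _ =>
      continuous_abs.comp ((continuous_apply j).comp ((continuous_apply i).comp
        (hRc.fun_mul continuous_const)))).continuousOn
  obtain ⟨N', hN'⟩ := hKc.bddAbove_image hcontB
  have hN'' : ∀ ω ∈ sphere (0 : Fin d → ℝ) 1, ∑ i, ∑ j, |(R ω * Bm) i j| ≤ N' :=
    fun ω hω => hN' ⟨ω, hω, rfl⟩
  -- constants at `ξ = 0` with the symmetrizer `A₀ᵀ`
  have hpd0 : (A₀ᵀ * A₀).PosDef := by
    have hinj : Function.Injective A₀.mulVec :=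
      mulVec_injective_iff_isUnit.2 ((isUnit_iff_isUnit_det _).2 (isUnit_iff_ne_zero.2 hdet))
    refine Matrix.PosDef.of_dotProduct_mulVec_pos ?_ fun x hx => ?_
    · show (A₀ᵀ * A₀)ᴴ = A₀ᵀ * A₀
      rw [conjTranspose_eq_transpose_of_trivial, transpose_mul, transpose_transpose]
    · rw [star_trivial, ← mulVec_mulVec, dotProduct_mulVec, vecMul_transpose]
      have hne : A₀ *ᵥ x ≠ 0 := fun h0 => hx (hinj (by rw [h0, mulVec_zero]))
      exact lt_of_le_of_ne (dotProduct_self_nonneg_real _)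
        (Ne.symm fun h0 => hne (dotProduct_self_eq_zero.1 h0))
  obtain ⟨m₀, N₀, hm₀, hcoer₀, hN₀⟩ := exists_uniform_quadForm_bounds (k := k) (X := Unit)
    (K := {()}) isCompact_singleton (Q := fun _ => A₀ᵀ * A₀) continuousOn_const
    fun _ _ => hpd0
  set N₀' : ℝ := ∑ i, ∑ j, |(A₀ᵀ * Bm) i j| with hN₀'
  -- the two candidate bounds, made monotone in `|t| ≤ T` via `|T|`
  set C₁ : ℝ := Real.sqrt (Real.exp (2 * (|T| * N' / m)) * N / m) with hC₁
  set C₂ : ℝ := Real.sqrt (Real.exp (2 * (|T| * N₀' / m₀)) * N₀ / m₀) with hC₂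
  refine ⟨max C₁ C₂, fun t ht ξ a b => ?_⟩
  have htT : |t| ≤ |T| := ht.trans (le_abs_self T)
  rcases eq_or_ne ξ 0 with rfl | hξ
  · -- `ξ = 0`: symmetrizer `A₀ᵀ`
    refine le_trans ?_ (le_max_right _ _)
    have hsymm₀ : (A₀ᵀ * A₀).IsSymm := by
      show (A₀ᵀ * A₀)ᵀ = A₀ᵀ * A₀; rw [transpose_mul, transpose_transpose]
    have hsymm : (A₀ᵀ * ∑ l, (0 : Space d) l • A l).IsSymm := by
      simp [Matrix.IsSymm]
    have hN₀1 : ∑ i, ∑ j, |(A₀ᵀ * A₀) i j| ≤ N₀ := hN₀ () (Set.mem_singleton _)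
    have h := norm_rauchSymbol_apply_le_of_symmetrizer hdet A B₁ hsymm₀ hsymm hm₀
      (hcoer₀ () (Set.mem_singleton _)) hN₀1 le_rfl t a b
    refine h.trans (Real.sqrt_le_sqrt ?_)
    have hN₀0 : 0 ≤ N₀ := le_trans
      (Finset.sum_nonneg fun i _ => Finset.sum_nonneg fun j _ => abs_nonneg _) hN₀1
    have hN₀'0 : 0 ≤ N₀' :=
      Finset.sum_nonneg fun i _ => Finset.sum_nonneg fun j _ => abs_nonneg _
    gcongr
  · -- `ξ ≠ 0`: symmetrizer `R(ω)`, `ω = ξ/‖ξ‖`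
    refine le_trans ?_ (le_max_left _ _)
    have hnξ : ‖(ξ : Fin d → ℝ)‖ ≠ 0 :=
      norm_ne_zero_iff.2 fun h0 => hξ ((WithLp.ofLp_eq_zero 2).1 h0)
    set ω : Fin d → ℝ := ‖(ξ : Fin d → ℝ)‖⁻¹ • (ξ : Fin d → ℝ) with hω
    have hωS : ω ∈ sphere (0 : Fin d → ℝ) 1 := by
      rw [mem_sphere_zero_iff_norm, hω, norm_smul, norm_inv, norm_norm, inv_mul_cancel₀ hnξ]
    have hω0 : ω ≠ 0 := hne0 ω hωS
    obtain ⟨hpd, hsymm₀, hsymmω⟩ := hR ω hω0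
    -- `R(ω) A(ξ) = ‖ξ‖ R(ω) A(ω)` is symmetric
    have hsymm : (R ω * ∑ l, ξ l • A l).IsSymm := by
      have hsum : ∑ l, ξ l • A l = ‖(ξ : Fin d → ℝ)‖ • ∑ l, ω l • A l := by
        rw [Finset.smul_sum]
        refine Finset.sum_congr rfl fun l _ => ?_
        rw [smul_smul, hω, Pi.smul_apply, smul_eq_mul, ← mul_assoc, mul_inv_cancel₀ hnξ, one_mul]
      rw [hsum, Matrix.mul_smul]
      exact hsymmω.smul _
    have h := norm_rauchSymbol_apply_le_of_symmetrizer hdet A B₁ hsymm₀ hsymm hm (hcoer ω hωS)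
      (hN ω hωS) (hN'' ω hωS) t a b
    refine h.trans (Real.sqrt_le_sqrt ?_)
    have hN0 : 0 ≤ N := le_trans
      (Finset.sum_nonneg fun i _ => Finset.sum_nonneg fun j _ => abs_nonneg _) (hN ω hωS)
    have hN'0 : 0 ≤ N' := le_trans
      (Finset.sum_nonneg fun i _ => Finset.sum_nonneg fun j _ => abs_nonneg _) (hN'' ω hωS)
    gcongr

/-- The bound at a single time `T`. [cite: Rauch1986, Proof of Theorem p. 483] -/
theorem exists_norm_rauchSymbol_apply_le_single {A₀ : Matrix (Fin k) (Fin k) ℝ}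
    {A : Fin d → Matrix (Fin k) (Fin k) ℝ} {B₁ : (Fin k → ℝ) →L[ℝ] (Fin k → ℝ)}
    (hS : (ofConstant A₀ A B₁).IsRauchClass 0) (T : ℝ) :
    ∃ C₀ : ℝ, ∀ (ξ : Space d) (a b : Fin k), ‖rauchSymbol A₀ A B₁ T ξ a b‖ ≤ C₀ := by
  obtain ⟨C₀, hC₀⟩ := exists_norm_rauchSymbol_apply_le hS |T|
  exact ⟨C₀, fun ξ a b => hC₀ T le_rfl ξ a b⟩

/-! ### Continuity and measurability of the multiplier -/

/-- The generator `ξ ↦ A₀⁻¹(2πi Σ ξ_l A_l + B₁)` is continuous (affine in `ξ`).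
[cite: Rauch1986, Proof of Theorem p. 483] -/
theorem continuous_rauchGenerator (A₀ : Matrix (Fin k) (Fin k) ℝ)
    (A : Fin d → Matrix (Fin k) (Fin k) ℝ) (B₁ : (Fin k → ℝ) →L[ℝ] (Fin k → ℝ)) :
    Continuous (rauchGenerator A₀ A B₁) := by
  unfold rauchGenerator
  refine continuous_const.fun_mul (Continuous.fun_add ?_ continuous_const)
  refine continuous_finsetSum _ fun l _ => Continuous.fun_smul ?_ continuous_const
  have hl : Continuous fun ξ : Space d => ((ξ l : ℝ) : ℂ) :=
    Complex.continuous_ofReal.comp (PiLp.continuous_apply 2 _ l)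
  exact (continuous_const.fun_mul hl).fun_mul continuous_const

/-- **Rauch's multiplier is continuous in `ξ`** (hence measurable).
[cite: Rauch1986, Proof of Theorem p. 483] -/
theorem continuous_rauchSymbol (A₀ : Matrix (Fin k) (Fin k) ℝ) (A : Fin d → Matrix (Fin k) (Fin k) ℝ)
    (B₁ : (Fin k → ℝ) →L[ℝ] (Fin k → ℝ)) (T : ℝ) : Continuous (rauchSymbol A₀ A B₁ T) := by
  unfold rauchSymbol
  exact NormedSpace.exp_continuous.comp
    ((continuous_rauchGenerator A₀ A B₁).const_smul (-(T : ℂ)) :)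

/-- Entries of Rauch's multiplier are measurable in `ξ`. [folklore] -/
theorem measurable_rauchSymbol_apply (A₀ : Matrix (Fin k) (Fin k) ℝ)
    (A : Fin d → Matrix (Fin k) (Fin k) ℝ) (B₁ : (Fin k → ℝ) →L[ℝ] (Fin k → ℝ)) (T : ℝ)
    (a b : Fin k) : Measurable fun ξ => rauchSymbol A₀ A B₁ T ξ a b :=
  ((continuous_apply b).comp ((continuous_apply a).comp
    (continuous_rauchSymbol A₀ A B₁ T))).measurable

end Bound

end Literature.Barriers.AtomisticToContinuum

end
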